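/-
Copyright (c) 2026 the pub-hodgecm-mathlib formalisation cell (harness21).  Prover seat hodgecm-mathlib-K2E5-p17 (g4), Track B «K2-LIT» ∕ h413
(`stmt-HodgeConjecture-24833`), line `K2_E3_EllipticInputs`, unit U12 «Characters», road «GL-[M6]-sc» (line lead K2E3-p23 (g5), RULINGS #4 (M4-3)
2026-09-04T06:15Z: brick B0b `K2E3CharLocIntNearCoveringTransport`), part 1 of 2: «A HAAR MEASURE PUSHES FORWARD LOCALLY, ALONG A COVERING HOMOMORPHISM,
TO A CONSTANT MULTIPLE OF HAAR MEASURE».  2026-09-04.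
-/
import Mathlib.MeasureTheory.Measure.Haar.Unique
import Mathlib.Topology.Algebra.OpenSubgroup
import HarnessLib

/-!
# K2_E3 road (h413), U12 «Characters», brick B0b part 1: local push-forward of Haar measure along an open homomorphism with discrete kernel

Cell `pub/hodgecm-mathlib` (D-0151), Track B, seat K2E5-p17 (g4) (free E5 hand serving the E3 road «GL-[M6]-sc» by name); line lead K2E3-p23 (g5), dealer
K2E3-plan (g3).  `--supports stmt-HodgeConjecture-24833 --as helper`; THEOREMS ONLY (no definition ∕ instance ∕ notation ∕ named fact ∕ `sorry`); never imports
`Cruxes/…/Lines`; Mathlib only.  COUNT-NEUTRAL.  Consumer: part 2 `K2E3CharLocIntNearCoveringTransport` (transport of «`χ_π` is an integrable function near `s`»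
from `G'` to `G` along a covering homomorphism `p : G → G'`, e.g. `GL₃(F) → GL₃(F) ⧸ ϖ^ℤ`).

THE MATHEMATICS.  Let `p : G →* G'` be a continuous OPEN homomorphism of locally compact second countable groups and `V ≤ G` an open subgroup on which
`p` is injective (for a discrete kernel such `V` exist).  Then `p|_V : V → p(V)` is an isomorphism of topological groups onto the open subgroup `p(V) ≤ G'`;
Haar measure of `G` (resp. `G'`) restricted to the open subgroup `V` (resp. `p(V)`) is a Haar measure there (Mathlib `IsHaarMeasure.comap` along the open
embedding `V ↪ G`); transporting the first along `p|_V` gives a second Haar measure on `p(V)`, hence (uniqueness, Mathlib `isMulLeftInvariant_eq_smul`) a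
constant `c ∈ (0, ∞)` with **`p_*(μ|_V) = c · μ'|_{p(V)}`**, and by left translation **`p_*(μ|_{gV}) = c · μ'|_{p(g) p(V)}`** for every `g ∈ G` — the
same `c` for all `g`.  No fundamental domain and no properness of `p` is needed.
* §1 the local inverse `σ = invFunOn p V` and the isomorphism `p|_V : ↥V ≃ₜ* ↥p(V)` (continuity of the inverse from openness of `p`);
* §2 **`exists_map_restrict_smul_eq`** — the push-forward identity above, for all left cosets `g V` at once.
[WeilBNT1967, Ch. II §5 (Haar measure and local isomorphisms; the module of a homomorphism)]; [Bourbaki, *Intégration* VII §2 no. 7 Prop. 10 (quotients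
by discrete subgroups)]; [HarishChandra1970, Part I §1 (passage between `G` and `G/Z`)].

HONEST LABEL: HC_CM is proved only modulo the 7 printed citations (2 remaining named inputs: hLiu418 = stmt-HodgeConjecture-24832, h413 = stmt-HodgeConjecture-24833)
until rung 0 closes; count-neutral helper.
-/

set_option autoImplicit false
set_option linter.dupNamespace false   -- `Summit.HodgeConjecture.HodgeConjecture.…` (D-0017 nested layout; lakefile exemption for Summits)

noncomputable section

open MeasureTheory MeasureTheory.Measure Set Function Topology Filter
open scoped NNReal ENNReal Pointwise

namespace Summit.HodgeConjecture.HodgeConjecture.Cruxes.H413.K2E3CoveringHomLocalHaar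

/-! ## §1  The local inverse and the isomorphism `p|_V : V ≃ p(V)` -/

section Algebra

variable {G G' : Type*} [Group G] [Group G'] (p : G →* G') (V : Subgroup G)

/-- `p` is injective on a subgroup `V` meeting `ker p` trivially. [folklore] -/
theorem injOn_of_forall_eq_one (hV : ∀ x ∈ V, p x = 1 → x = 1) : Set.InjOn p (V : Set G) := by
  intro x hx y hy hxy
  have h : p (x⁻¹ * y) = 1 := by rw [map_mul, map_inv, hxy, inv_mul_cancel]
  have h1 : x⁻¹ * y = 1 := hV _ (V.mul_mem (V.inv_mem hx) hy) h
  rw [← mul_one x, ← h1, mul_inv_cancel_left]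

/-- The local inverse `σ := invFunOn p V` lands in `V` and is a right inverse of `p` on `p(V)`. [folklore] -/
theorem invFunOn_mem_and_apply [Nonempty G] {y : G'} (hy : y ∈ p '' (V : Set G)) :
    Function.invFunOn p (V : Set G) y ∈ (V : Set G) ∧ p (Function.invFunOn p (V : Set G) y) = y := by
  obtain ⟨x, hx, rfl⟩ := hy
  exact ⟨Function.invFunOn_mem ⟨x, hx, rfl⟩, Function.invFunOn_eq ⟨x, hx, rfl⟩⟩

/-- The local inverse is a left inverse of `p` on `V` when `p` is injective there. [folklore] -/
theorem invFunOn_apply_of_mem [Nonempty G] (hV : ∀ x ∈ V, p x = 1 → x = 1) {x : G} (hx : x ∈ V) :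
    Function.invFunOn p (V : Set G) (p x) = x :=
  (injOn_of_forall_eq_one p V hV).leftInvOn_invFunOn hx

/-- The local inverse is multiplicative on `p(V)`. [folklore] -/
theorem invFunOn_mul [Nonempty G] (hV : ∀ x ∈ V, p x = 1 → x = 1) {y y' : G'} (hy : y ∈ p '' (V : Set G)) (hy' : y' ∈ p '' (V : Set G)) :
    Function.invFunOn p (V : Set G) (y * y') = Function.invFunOn p (V : Set G) y * Function.invFunOn p (V : Set G) y' := by
  obtain ⟨hm, he⟩ := invFunOn_mem_and_apply p V hy
  obtain ⟨hm', he'⟩ := invFunOn_mem_and_apply p V hy'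
  have h := invFunOn_apply_of_mem p V hV (V.mul_mem hm hm')
  rw [map_mul, he, he'] at h
  exact h

/-- `p(V)` as a set is the carrier of the subgroup `V.map p`. [folklore] -/
theorem coe_map_eq : ((V.map p : Subgroup G') : Set G') = p '' (V : Set G) := Subgroup.coe_map p V

/-- `p⁻¹(p(g) • B) = g • p⁻¹(B)`. [folklore] -/
theorem preimage_smul_eq (g : G) (B : Set G') : p ⁻¹' (p g • B) = g • (p ⁻¹' B) := by
  ext x
  rw [Set.mem_preimage, Set.mem_smul_set_iff_inv_smul_mem, Set.mem_smul_set_iff_inv_smul_mem, Set.mem_preimage, smul_eq_mul, smul_eq_mul,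
    map_mul, map_inv]

end Algebra

/-! ## §2  The local push-forward of Haar measure -/

section Haar

variable {G G' : Type*} [Group G] [TopologicalSpace G] [IsTopologicalGroup G] [MeasurableSpace G] [BorelSpace G]
  [Group G'] [TopologicalSpace G'] [IsTopologicalGroup G'] [LocallyCompactSpace G'] [SecondCountableTopology G']
  [MeasurableSpace G'] [BorelSpace G']

omit [IsTopologicalGroup G] [MeasurableSpace G] [BorelSpace G] [IsTopologicalGroup G'] [LocallyCompactSpace G'] [SecondCountableTopology G']
  [MeasurableSpace G'] [BorelSpace G'] in
/-- **The open subgroup `V`, on which `p` is injective, is isomorphic to the open subgroup `p(V)` as a topological group** — existence of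
`e : ↥V ≃ₜ* ↥(V.map p)` with `↑(e x) = p ↑x` (continuity of `e⁻¹` from openness of `p`). [cite: WeilBNT1967, Ch. II §5] -/
theorem exists_continuousMulEquiv_subgroup (p : G →* G') (hpc : Continuous p) (hpo : IsOpenMap p) (V : Subgroup G) (hVo : IsOpen (V : Set G))
    (hV : ∀ x ∈ V, p x = 1 → x = 1) :
    ∃ e : ↥V ≃ₜ* ↥(V.map p), ∀ x : ↥V, ((e x : ↥(V.map p)) : G') = p (x : G) := by
  classical
  have hinj := injOn_of_forall_eq_one p V hV
  -- the algebraic isomorphism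
  let e₀ : ↥V ≃ ↥(V.map p) :=
    { toFun := fun x => ⟨p x, Subgroup.mem_map_of_mem p x.2⟩
      invFun := fun y => ⟨Function.invFunOn p (V : Set G) y,
        (invFunOn_mem_and_apply p V (by rw [← coe_map_eq]; exact y.2)).1⟩
      left_inv := fun x => Subtype.ext (invFunOn_apply_of_mem p V hV x.2)
      right_inv := fun y => Subtype.ext (invFunOn_mem_and_apply p V (by rw [← coe_map_eq]; exact y.2)).2 }
  have he₀ : ∀ x : ↥V, ((e₀ x : ↥(V.map p)) : G') = p (x : G) := fun _ => rfl
  have hcont : Continuous e₀ := (hpc.comp continuous_subtype_val).subtype_mk _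
  -- `e₀` is open: the image of `V ∩ O` is `p(V ∩ O)`, open in `G'`
  have hopen : IsOpenMap e₀ := by
    intro U hU
    obtain ⟨O, hO, rfl⟩ := isOpen_induced_iff.1 hU
    have himg : (e₀ '' (Subtype.val ⁻¹' O) : Set ↥(V.map p)) = Subtype.val ⁻¹' (p '' (O ∩ (V : Set G))) := by
      ext y
      constructor
      · rintro ⟨x, hx, rfl⟩
        exact ⟨(x : G), ⟨hx, x.2⟩, (he₀ x).symm⟩
      · rintro ⟨x, ⟨hxO, hxV⟩, hxy⟩
        refine ⟨⟨x, hxV⟩, hxO, Subtype.ext ?_⟩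
        rw [he₀]; exact hxy
    rw [himg]
    exact (hpo _ (hO.inter hVo)).preimage continuous_subtype_val
  let eh : ↥V ≃ₜ ↥(V.map p) := e₀.toHomeomorphOfContinuousOpen hcont hopen
  let em : ↥V ≃* ↥(V.map p) :=
    { e₀ with
      map_mul' := fun x y => Subtype.ext (by
        show p ((x : G) * (y : G)) = p (x : G) * p (y : G)
        exact map_mul p _ _) }
  exact ⟨{ toMulEquiv := em, continuous_toFun := hcont, continuous_invFun := eh.symm.continuous }, fun x => rfl⟩

/-- **THE LOCAL PUSH-FORWARD OF HAAR MEASURE ALONG A COVERING HOMOMORPHISM.**  Let `p : G →* G'` be a continuous open homomorphism of locally compact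
second countable groups, `V ≤ G` an open subgroup with `V ∩ ker p = {1}`, `μ`, `μ'` Haar measures on `G`, `G'`.  Then there is ONE constant `c ∈ (0,∞)` with
`p_*(μ|_{gV}) = c · μ'|_{p(g)·p(V)}` for every `g ∈ G`.  (Restrict to the open subgroups `V ≃ p(V)`, where both sides are Haar measures; uniqueness; then
translate.) [cite: WeilBNT1967, Ch. II §5] [cite: HarishChandra1970, Part I §1] -/
theorem exists_map_restrict_smul_eq (p : G →* G') (hpc : Continuous p) (hpo : IsOpenMap p) (V : Subgroup G) (hVo : IsOpen (V : Set G))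
    (hV : ∀ x ∈ V, p x = 1 → x = 1) (μ : Measure G) [μ.IsHaarMeasure] (μ' : Measure G') [μ'.IsHaarMeasure] :
    ∃ c : ℝ≥0, 0 < c ∧ ∀ g : G, (μ.restrict (g • (V : Set G))).map p = c • μ'.restrict (p g • (p '' (V : Set G))) := by
  classical
  -- the two open subgroups and the isomorphism
  set W : Subgroup G' := V.map p with hWdef
  have hWo : IsOpen (W : Set G') := by rw [hWdef, Subgroup.coe_map]; exact hpo _ hVo
  obtain ⟨e, he⟩ := exists_continuousMulEquiv_subgroup p hpc hpo V hVo hV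
  haveI : LocallyCompactSpace ↥W := hWo.isOpenEmbedding_subtypeVal.locallyCompactSpace
  haveI : SecondCountableTopology ↥W := hWo.isOpenEmbedding_subtypeVal.isEmbedding.secondCountableTopology
  have hembV : MeasurableEmbedding (Subtype.val : ↥V → G) := hVo.isOpenEmbedding_subtypeVal.measurableEmbedding
  have hembW : MeasurableEmbedding (Subtype.val : ↥W → G') := hWo.isOpenEmbedding_subtypeVal.measurableEmbedding
  have hrangeV : Set.range (Subtype.val : ↥V → G) = (V : Set G) := Subtype.range_coe
  have hrangeW : Set.range (Subtype.val : ↥W → G') = (W : Set G') := Subtype.range_coe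
  -- Haar measures of the open subgroups
  set μV : Measure ↥V := μ.comap (Subtype.val : ↥V → G) with hμV
  set μW : Measure ↥W := μ'.comap (Subtype.val : ↥W → G') with hμW
  haveI : μV.IsHaarMeasure := by
    have h := IsHaarMeasure.comap (mH := inferInstance) μ (f := V.subtype) hVo.isOpenEmbedding_subtypeVal
    rw [Subgroup.coe_subtype] at h
    exact h
  haveI : μW.IsHaarMeasure := by
    have h := IsHaarMeasure.comap (mH := inferInstance) μ' (f := W.subtype) hWo.isOpenEmbedding_subtypeVal
    rw [Subgroup.coe_subtype] at h
    exact h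
  -- transport and uniqueness on `↥p(V)`
  haveI : (μV.map e).IsHaarMeasure := e.isHaarMeasure_map μV
  set c : ℝ≥0 := haarScalarFactor (μV.map e) μW with hc
  have hcpos : 0 < c := haarScalarFactor_pos_of_isHaarMeasure _ _
  have huniq : μV.map e = c • μW := isMulLeftInvariant_eq_smul (μV.map e) μW
  -- push forward to `G'`: `p_*(μ|_V) = c · μ'|_{p(V)}`
  have hmeasV : MeasurableSet (V : Set G) := hVo.measurableSet
  have hmeasW : MeasurableSet (W : Set G') := hWo.measurableSet
  have hpm : Measurable p := hpc.measurable
  have hval : Measurable (Subtype.val : ↥W → G') := measurable_subtype_coe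
  have hem : Measurable (e : ↥V → ↥W) := (e.continuous.measurable : Measurable (e : ↥V → ↥W))
  have he' : (Subtype.val : ↥W → G') ∘ e = p ∘ (Subtype.val : ↥V → G) := by
    funext x; exact he x
  have h1 : (μ.restrict (V : Set G)).map p = c • μ'.restrict (W : Set G') := by
    have hl : (μV.map e).map (Subtype.val : ↥W → G') = (μ.restrict (V : Set G)).map p := by
      rw [Measure.map_map hval hem, he', ← Measure.map_map hpm measurable_subtype_coe, hμV, hembV.map_comap, hrangeV]
    have hr : (c • μW).map (Subtype.val : ↥W → G') = c • μ'.restrict (W : Set G') := by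
      rw [Measure.map_smul, hμW, hembW.map_comap, hrangeW]
    rw [← hl, huniq, hr]
  refine ⟨c, hcpos, fun g => ?_⟩
  -- translate by `g` on `G` and by `p g` on `G'`
  have hg : Measurable fun x : G => g • x := measurable_const_smul g
  have hg' : Measurable fun y : G' => p g • y := measurable_const_smul (p g)
  have hpre : (fun x : G => g • x) ⁻¹' (g • (V : Set G)) = (V : Set G) := by rw [Set.preimage_smul, inv_smul_smul]
  have hpre' : (fun y : G' => p g • y) ⁻¹' (p g • (W : Set G')) = (W : Set G') := by rw [Set.preimage_smul, inv_smul_smul]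
  have hL : μ.restrict (g • (V : Set G)) = (μ.restrict (V : Set G)).map (fun x : G => g • x) := by
    have h := Measure.restrict_map (μ := μ) hg (s := g • (V : Set G)) (hmeasV.const_smul g)
    rw [hpre] at h
    rw [← h, show (fun x : G => g • x) = (fun x : G => g * x) from rfl, map_mul_left_eq_self]
  have hR : μ'.restrict (p g • (W : Set G')) = (μ'.restrict (W : Set G')).map (fun y : G' => p g • y) := by
    have h := Measure.restrict_map (μ := μ') hg' (s := p g • (W : Set G')) (hmeasW.const_smul (p g))
    rw [hpre'] at h
    rw [← h, show (fun y : G' => p g • y) = (fun y : G' => p g * y) from rfl, map_mul_left_eq_self]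
  have hcomp : p ∘ (fun x : G => g • x) = (fun y : G' => p g • y) ∘ p := by
    funext x
    simp only [Function.comp_apply, smul_eq_mul, map_mul]
  rw [show p '' (V : Set G) = (W : Set G') from (Subgroup.coe_map p V).symm, hL, hR, Measure.map_map hpm hg, hcomp,
    ← Measure.map_map hg' hpm, h1, Measure.map_smul]

/-! ## §3  The push-forward identity read on integrals -/

omit [TopologicalSpace G] [IsTopologicalGroup G] [BorelSpace G] [TopologicalSpace G'] [IsTopologicalGroup G'] [LocallyCompactSpace G']
  [SecondCountableTopology G'] [BorelSpace G'] in
/-- **Substitution along `p` on a coset, `ℝ≥0∞`-valued**: `∫_{gV} φ(p x) dμ = c · ∫_{p(g)p(V)} φ dμ'` for measurable `φ ≥ 0`, given the push-forward identity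
`p_*(μ|_{gV}) = c · μ'|_{p(g)p(V)}`. [cite: WeilBNT1967, Ch. II §5] -/
theorem setLIntegral_comp_eq_of_map_restrict_eq {p : G →* G'} (hpm : Measurable p) {V : Subgroup G} {μ : Measure G} {μ' : Measure G'} {c : ℝ≥0} {g : G}
    (h : (μ.restrict (g • (V : Set G))).map p = c • μ'.restrict (p g • (p '' (V : Set G)))) (φ : G' → ℝ≥0∞) (hφ : Measurable φ) :
    ∫⁻ x in g • (V : Set G), φ (p x) ∂μ = (c : ℝ≥0∞) * ∫⁻ y in p g • (p '' (V : Set G)), φ y ∂μ' := by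
  rw [← lintegral_map hφ hpm, h, lintegral_smul_measure]
  rfl

omit [TopologicalSpace G] [IsTopologicalGroup G] [BorelSpace G] [TopologicalSpace G'] [IsTopologicalGroup G'] [LocallyCompactSpace G']
  [SecondCountableTopology G'] [BorelSpace G'] in
/-- **Substitution along `p` on a coset, Bochner form**: `∫_{gV} φ(p x) dμ = c · ∫_{p(g)p(V)} φ dμ'` for `φ` a.e.-strongly measurable on `p(g)p(V)`, given the
push-forward identity `p_*(μ|_{gV}) = c · μ'|_{p(g)p(V)}` (no integrability needed: both sides vanish together). [cite: WeilBNT1967, Ch. II §5] -/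
theorem setIntegral_comp_eq_of_map_restrict_eq {E : Type*} [NormedAddCommGroup E] [NormedSpace ℝ E] {p : G →* G'} (hpm : Measurable p) {V : Subgroup G}
    {μ : Measure G} {μ' : Measure G'} {c : ℝ≥0} {g : G} (h : (μ.restrict (g • (V : Set G))).map p = c • μ'.restrict (p g • (p '' (V : Set G))))
    (φ : G' → E) (hφ : AEStronglyMeasurable φ (μ'.restrict (p g • (p '' (V : Set G))))) :
    ∫ x in g • (V : Set G), φ (p x) ∂μ = c • ∫ y in p g • (p '' (V : Set G)), φ y ∂μ' := by
  have hφ' : AEStronglyMeasurable φ ((μ.restrict (g • (V : Set G))).map p) := by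
    rw [h]; exact hφ.smul_measure c
  rw [← integral_map hpm.aemeasurable hφ', h, integral_smul_nnreal_measure]

end Haar

end Summit.HodgeConjecture.HodgeConjecture.Cruxes.H413.K2E3CoveringHomLocalHaar
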